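import Literature.NumberTheory.DiophantineApproximation.ContinuedFractionExpOne
import Mathlib.Algebra.ContinuedFractions.Computation.Translations
import Mathlib.Analysis.Calculus.Deriv.Pow
import Mathlib.Analysis.SpecialFunctions.ExpDeriv
import Mathlib.MeasureTheory.Integral.IntervalIntegral.FundThmCalculus
import HarnessLib

/-!
# Euler's continued fraction of `e`: the proof (discharge of `EulerContFractExpOne`)

Topic: `Literature/NumberTheory/DiophantineApproximation`. This file proves
`theorem EulerContFractExpOne_holds : EulerContFractExpOne`, discharging the named fact of
`ContinuedFractionExpOne.lean` (`e = [2; 1, 2, 1, 1, 4, 1, 1, 6, …]` in Mathlib's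
`GenContFract.of (Real.exp 1)`, [Angell2021, Thm 4.22]); it is kept in a sibling module so that
the fact file and its importers do not acquire the calculus imports. Sources: D. Angell,
*Irrationality and Transcendence in Number Theory* (CRC 2022), Thm 4.22 and Exercise 4.22 with
its hint; H. Cohn, *A short proof of the simple continued fraction expansion of e*, Amer. Math.
Monthly 113 (2006) 57–62, Proposition 1 and Theorem 1 (Hermite's integrals).

## The argument

We follow Hermite's method as set in [Angell2021, Exercise 4.22 + hint] (a one-page version is
[Cohn2006, Prop. 1 and Thm 1]); Angell's main-text proof of Thm 4.22 (via `f(c; z)`, Lemma 4.18,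
Thms 4.19–4.20 and the uniqueness Lemma 4.7) would need the convergence/uniqueness theory of
infinite continued fractions, which Mathlib lacks, so we take the exercise's road. Write
`M(i, j) := ∫₀¹ xⁱ (1 − x)ʲ eˣ dx` (`> 0`). Angell's integrals are, up to sign,
`|I_k| = M(k+1, k)/k!`, `|J_k| = M(k, k+1)/k!`, `|K_k| = M(k+1, k+1)/(k+1)!`, and the hint's
tools "write one factor `x` as `(x − 1) + 1`" and "integrate by parts" are the identities
`integral_split : M(i, j) = M(i+1, j) + M(i, j+1)` and
`integral_parts : i·M(i−1, j) − j·M(i, j−1) + M(i, j) = 0ʲ·e − 0ⁱ` (FTC for `xⁱ(1−x)ʲeˣ`).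

Let `a₀ = 2` and `b n := a_{n+1}` (`= 2(⌊n/3⌋ + 1)` if `n % 3 = 1`, else `1`) be Euler's partial
quotients and `p_n/q_n` the convergents, `r_n = p_n − q_n e`. Instead of proving
`I_k = r_{3k−1}, J_k = r_{3k}, K_k = −r_{3k+1}` and then `r_n → 0 ⇒ α = e` (which again needs
limits of continued fractions), we run the SAME three-term recurrences on `u_n := |r_{n−1}|`
directly: `u₀ = 1, u₁ = e − 2, u_{n+2} = u_n − b_n u_{n+1}` (`seq_eq`, by the induction of the
hint: `u_{3k} = M(k+1,k)/k!`, `u_{3k+1} = M(k,k+1)/k!`, `u_{3k+2} = M(k+1,k+1)/(k+1)!`), so every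
`u_n > 0` (`seq_pos`). Positivity alone pins down Mathlib's expansion algorithm: from
`u_{n+2} = u_n − b_n u_{n+1} > 0`, `u_{n+3} > 0` and `b ≥ 1` we get `0 < u_{n+2} < u_{n+1}`, i.e.
`⌊u_n / u_{n+1}⌋ = b_n` with fractional part `u_{n+2}/u_{n+1}` (`floor_eq`, `fract_eq`), whence
by induction `IntFractPair.stream e (n+1) = ⟨b_n, u_{n+2}/u_{n+1}⟩` (`stream_exp_one_succ`:
the complete quotients of `e` are the ratios `u_n/u_{n+1}`), and `⌊e⌋ = 2` because
`u₁ = e − 2 > 0 < u₂ = 3 − e`. No limits, no irrationality input and no auxiliary definitions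
are needed (the sequence `u` is a universally quantified function satisfying the recurrence;
it is instantiated by `Nat.rec` in `EulerContFractExpOne_holds`).
-/

namespace Literature.NumberTheory.DiophantineApproximation

namespace EulerContFractExpOne

open _root_.MeasureTheory
open scoped Nat

/-- The integrand `x ↦ xⁱ (1 − x)ʲ eˣ` of Hermite's integral `M(i, j)` is continuous, hence
interval integrable. [cite: Angell2021, Exercise 4.22] -/
theorem integrable (i j : ℕ) (a b : ℝ) :
    IntervalIntegrable (fun x : ℝ => x ^ i * (1 - x) ^ j * Real.exp x) volume a b := by
  apply Continuous.intervalIntegrable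
  fun_prop

/-- Hermite's integrals are positive: `M(i, j) = ∫₀¹ xⁱ (1 − x)ʲ eˣ dx > 0` (the integrand is
positive on `(0, 1)`). [cite: Angell2021, Exercise 4.22] -/
theorem integral_pos (i j : ℕ) :
    0 < ∫ x in (0 : ℝ)..1, x ^ i * (1 - x) ^ j * Real.exp x := by
  refine intervalIntegral.intervalIntegral_pos_of_pos_on (integrable i j 0 1) (fun x hx => ?_)
    zero_lt_one
  have hx1 : 0 < 1 - x := sub_pos.mpr hx.2
  exact mul_pos (mul_pos (pow_pos hx.1 i) (pow_pos hx1 j)) (Real.exp_pos x)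

/-- "Write one of the factors `x` as `(x − 1) + 1`" [cite: Angell2021, Exercise 4.22 (hint)]:
`M(i, j) = M(i + 1, j) + M(i, j + 1)`, i.e. `1 = x + (1 − x)` under the integral sign. -/
theorem integral_split (i j : ℕ) :
    ∫ x in (0 : ℝ)..1, x ^ i * (1 - x) ^ j * Real.exp x =
      (∫ x in (0 : ℝ)..1, x ^ (i + 1) * (1 - x) ^ j * Real.exp x) +
        ∫ x in (0 : ℝ)..1, x ^ i * (1 - x) ^ (j + 1) * Real.exp x := by
  rw [← intervalIntegral.integral_add (integrable (i + 1) j 0 1) (integrable i (j + 1) 0 1)]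
  refine intervalIntegral.integral_congr fun x _ => ?_
  ring

/-- "Integrate by parts" [cite: Angell2021, Exercise 4.22 (hint)]: the fundamental theorem of
calculus for `x ↦ xⁱ (1 − x)ʲ eˣ` on `[0, 1]` reads
`i·M(i − 1, j) − j·M(i, j − 1) + M(i, j) = 0ʲ·e − 0ⁱ` (with `ℕ`-subtraction: for `i = 0`,
resp. `j = 0`, the corresponding term vanishes because of the factor `i`, resp. `j`). -/
theorem integral_parts (i j : ℕ) :
    (i : ℝ) * (∫ x in (0 : ℝ)..1, x ^ (i - 1) * (1 - x) ^ j * Real.exp x) -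
        (j : ℝ) * (∫ x in (0 : ℝ)..1, x ^ i * (1 - x) ^ (j - 1) * Real.exp x) +
      ∫ x in (0 : ℝ)..1, x ^ i * (1 - x) ^ j * Real.exp x =
    (0 : ℝ) ^ j * Real.exp 1 - (0 : ℝ) ^ i := by
  have hderiv : ∀ x ∈ Set.uIcc (0 : ℝ) 1,
      HasDerivAt (fun x : ℝ => x ^ i * (1 - x) ^ j * Real.exp x)
        ((i : ℝ) * (x ^ (i - 1) * (1 - x) ^ j * Real.exp x) -
            (j : ℝ) * (x ^ i * (1 - x) ^ (j - 1) * Real.exp x) +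
          x ^ i * (1 - x) ^ j * Real.exp x) x := by
    intro x _
    have h1 : HasDerivAt (fun x : ℝ => x ^ i) ((i : ℝ) * x ^ (i - 1)) x := hasDerivAt_pow i x
    have h2 : HasDerivAt (fun x : ℝ => (1 - x) ^ j) ((j : ℝ) * (1 - x) ^ (j - 1) * -1) x :=
      ((hasDerivAt_id' (x := x)).const_sub 1).fun_pow j
    refine ((h1.fun_mul h2).fun_mul (Real.hasDerivAt_exp x)).congr_deriv ?_
    ring
  have hA := ((integrable (i - 1) j 0 1).const_mul (i : ℝ)).sub
    ((integrable i (j - 1) 0 1).const_mul (j : ℝ))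
  have key := intervalIntegral.integral_eq_sub_of_hasDerivAt hderiv (hA.add (integrable i j 0 1))
  rw [intervalIntegral.integral_add hA (integrable i j 0 1),
    intervalIntegral.integral_sub ((integrable (i - 1) j 0 1).const_mul (i : ℝ))
      ((integrable i (j - 1) 0 1).const_mul (j : ℝ)),
    intervalIntegral.integral_const_mul, intervalIntegral.integral_const_mul] at key
  rw [key]
  simp

/-- The integration-by-parts identity at successor indices:
`M(i+1, j+1) = (j+1)·M(i+1, j) − (i+1)·M(i, j+1)` (the boundary terms vanish).
[cite: Angell2021, Exercise 4.22 (hint)] -/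
theorem integral_parts_succ (i j : ℕ) :
    ∫ x in (0 : ℝ)..1, x ^ (i + 1) * (1 - x) ^ (j + 1) * Real.exp x =
      ((j : ℝ) + 1) * (∫ x in (0 : ℝ)..1, x ^ (i + 1) * (1 - x) ^ j * Real.exp x) -
        ((i : ℝ) + 1) * ∫ x in (0 : ℝ)..1, x ^ i * (1 - x) ^ (j + 1) * Real.exp x := by
  have h := integral_parts (i + 1) (j + 1)
  simp only [Nat.add_sub_cancel, Nat.cast_add, Nat.cast_one] at h
  rw [zero_pow i.succ_ne_zero, zero_pow j.succ_ne_zero, zero_mul, sub_zero] at h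
  linear_combination h

section Recurrence

/-! ### The sequence `u_n = |q_{n−1} e − p_{n−1}|`, through its recurrence only -/

variable {u : ℕ → ℝ} (hu0 : u 0 = 1) (hu1 : u 1 = Real.exp 1 - 2)
  (hu2 : ∀ n, u (n + 2) = u n - ((if n % 3 = 1 then 2 * (n / 3 + 1) else 1 : ℕ) : ℝ) * u (n + 1))
include hu0 hu1 hu2

omit hu0 hu1 in
/-- The recurrence `u_{n+2} = u_n − b_n u_{n+1}` spelled out on the three residue classes
(`b_{3k} = 1`, `b_{3k+1} = 2(k+1)`, `b_{3k+2} = 1`), i.e. the hint's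
`r_{3k+2} = (2k+2) r_{3k+1} + r_{3k}`, `r_{3k+3} = r_{3k+2} + r_{3k+1}`,
`r_{3k+4} = r_{3k+3} + r_{3k+2}` in absolute values. [cite: Angell2021, Exercise 4.22 (hint)] -/
theorem rec_spec (k : ℕ) :
    u (3 * k + 2) = u (3 * k) - u (3 * k + 1) ∧
      u (3 * k + 3) = u (3 * k + 1) - 2 * ((k : ℝ) + 1) * u (3 * k + 2) ∧
        u (3 * k + 4) = u (3 * k + 2) - u (3 * k + 3) := by
  have a := hu2 (3 * k)
  have b := hu2 (3 * k + 1)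
  have c := hu2 (3 * k + 2)
  rw [if_neg (show ¬ (3 * k) % 3 = 1 by omega)] at a
  rw [if_pos (show (3 * k + 1) % 3 = 1 by omega), show (3 * k + 1) / 3 = k by omega,
    show 3 * k + 1 + 2 = 3 * k + 3 by ring, show 3 * k + 1 + 1 = 3 * k + 2 by ring] at b
  rw [if_neg (show ¬ (3 * k + 2) % 3 = 1 by omega), show 3 * k + 2 + 2 = 3 * k + 4 by ring,
    show 3 * k + 2 + 1 = 3 * k + 3 by ring] at c
  push_cast at a b c
  exact ⟨by linear_combination a, by linear_combination b, by linear_combination c⟩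

/-- **The integral formulae** (the induction of [cite: Angell2021, Exercise 4.22 (hint)];
[Cohn2006, Prop. 1]): `u_{3k} = M(k+1, k)/k! (= |I_k|)`, `u_{3k+1} = M(k, k+1)/k! (= |J_k|)`,
`u_{3k+2} = M(k+1, k+1)/(k+1)! (= |K_k|)`. -/
theorem seq_eq (k : ℕ) :
    u (3 * k) = (∫ x in (0 : ℝ)..1, x ^ (k + 1) * (1 - x) ^ k * Real.exp x) / (k ! : ℝ) ∧
      u (3 * k + 1) =
          (∫ x in (0 : ℝ)..1, x ^ k * (1 - x) ^ (k + 1) * Real.exp x) / (k ! : ℝ) ∧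
        u (3 * k + 2) =
          (∫ x in (0 : ℝ)..1, x ^ (k + 1) * (1 - x) ^ (k + 1) * Real.exp x) /
            ((k + 1) ! : ℝ) := by
  induction k with
  | zero =>
    obtain ⟨e2, -, -⟩ := rec_spec hu2 0
    have p00 := integral_parts 0 0
    have p10 := integral_parts 1 0
    have p11 := integral_parts_succ 0 0
    have s00 := integral_split 0 0
    norm_num at e2 p00 p10 p11 s00 ⊢
    refine ⟨?_, ?_, ?_⟩ <;> linarith
  | succ k ih =>
    obtain ⟨-, h1, h2⟩ := ih
    obtain ⟨-, e3, e4⟩ := rec_spec hu2 k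
    obtain ⟨e5, -, -⟩ := rec_spec hu2 (k + 1)
    have i0 : 3 * (k + 1) = 3 * k + 3 := by ring
    have i1 : 3 * (k + 1) + 1 = 3 * k + 4 := by ring
    have i2 : 3 * (k + 1) + 2 = 3 * k + 5 := by ring
    have j1 : k + 1 + 1 = k + 2 := rfl
    rw [i2, i1, i0] at e5
    rw [i1, i2, i0, j1]
    have pC := integral_parts_succ k k
    have pD := integral_parts_succ (k + 1) k
    have pF := integral_parts_succ (k + 1) (k + 1)
    have sA := integral_split (k + 1) k
    have sB := integral_split (k + 1) (k + 1)
    rw [j1] at pD pF sA sB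
    push_cast at pD pF
    have hf1 : (((k + 1) ! : ℕ) : ℝ) = ((k : ℝ) + 1) * (k ! : ℝ) := by
      rw [Nat.factorial_succ]; push_cast; ring
    have hf2 : (((k + 2) ! : ℕ) : ℝ) = ((k : ℝ) + 2) * (((k : ℝ) + 1) * (k ! : ℝ)) := by
      rw [Nat.factorial_succ, Nat.factorial_succ]; push_cast; ring
    have hk0 : (k ! : ℝ) ≠ 0 := by positivity
    have hk1 : (k : ℝ) + 1 ≠ 0 := by positivity
    have hk2 : (k : ℝ) + 2 ≠ 0 := by positivity
    have sA' : (∫ x in (0 : ℝ)..1, x ^ (k + 2) * (1 - x) ^ k * Real.exp x) =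
        (∫ x in (0 : ℝ)..1, x ^ (k + 1) * (1 - x) ^ k * Real.exp x) -
          ∫ x in (0 : ℝ)..1, x ^ (k + 1) * (1 - x) ^ (k + 1) * Real.exp x := by
      linarith
    have sB' : (∫ x in (0 : ℝ)..1, x ^ (k + 1) * (1 - x) ^ (k + 2) * Real.exp x) =
        (∫ x in (0 : ℝ)..1, x ^ (k + 1) * (1 - x) ^ (k + 1) * Real.exp x) -
          ∫ x in (0 : ℝ)..1, x ^ (k + 2) * (1 - x) ^ (k + 1) * Real.exp x := by
      linarith
    have g1 : u (3 * k + 3) =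
        (∫ x in (0 : ℝ)..1, x ^ (k + 2) * (1 - x) ^ (k + 1) * Real.exp x) /
          ((k + 1) ! : ℝ) := by
      rw [e3, h1, h2, pD, sA', pC, hf1]
      field_simp
      ring
    have g2 : u (3 * k + 4) =
        (∫ x in (0 : ℝ)..1, x ^ (k + 1) * (1 - x) ^ (k + 2) * Real.exp x) /
          ((k + 1) ! : ℝ) := by
      rw [e4, h2, g1, sB']
      ring
    have g3 : u (3 * k + 5) =
        (∫ x in (0 : ℝ)..1, x ^ (k + 2) * (1 - x) ^ (k + 2) * Real.exp x) /
          ((k + 2) ! : ℝ) := by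
      rw [e5, g1, g2, pF, hf2, hf1]
      field_simp
      ring
    exact ⟨g1, g2, g3⟩

/-- Every `u_n` is positive (each is a positive Hermite integral over a factorial).
[cite: Angell2021, Exercise 4.22] -/
theorem seq_pos (n : ℕ) : 0 < u n := by
  obtain ⟨k, hk⟩ : ∃ k, n = 3 * k ∨ n = 3 * k + 1 ∨ n = 3 * k + 2 := ⟨n / 3, by omega⟩
  obtain ⟨h0, h1, h2⟩ := seq_eq hu0 hu1 hu2 k
  rcases hk with rfl | rfl | rfl
  · rw [h0]; exact div_pos (integral_pos _ _) (by positivity)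
  · rw [h1]; exact div_pos (integral_pos _ _) (by positivity)
  · rw [h2]; exact div_pos (integral_pos _ _) (by positivity)

/-- `⌊e⌋ = 2`, from `u₁ = e − 2 > 0` and `u₂ = 3 − e > 0`. [folklore] -/
theorem floor_exp_one : ⌊Real.exp 1⌋ = 2 := by
  have h1 := seq_pos hu0 hu1 hu2 1
  have h2 := seq_pos hu0 hu1 hu2 2
  obtain ⟨a, -, -⟩ := rec_spec hu2 0
  norm_num at a
  rw [a, hu0, hu1] at h2
  rw [hu1] at h1
  rw [Int.floor_eq_iff]
  norm_num
  constructor <;> linarith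

/-- The partial quotients: `⌊u_n / u_{n+1}⌋ = b_n`, because
`b_n u_{n+1} < u_n < (b_n + 1) u_{n+1}` (i.e. `0 < u_{n+2} < u_{n+1}`, the latter from
`u_{n+3} = u_{n+1} − b_{n+1} u_{n+2} > 0` and `b_{n+1} ≥ 1`). [folklore] -/
theorem floor_eq (n : ℕ) :
    ⌊u n / u (n + 1)⌋ = ((if n % 3 = 1 then 2 * (n / 3 + 1) else 1 : ℕ) : ℤ) := by
  have hp0 := seq_pos hu0 hu1 hu2 n
  have hp1 := seq_pos hu0 hu1 hu2 (n + 1)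
  have hp2 := seq_pos hu0 hu1 hu2 (n + 2)
  have hp3 := seq_pos hu0 hu1 hu2 (n + 3)
  have r2 := hu2 n
  have r3 := hu2 (n + 1)
  rw [show n + 1 + 2 = n + 3 by ring, show n + 1 + 1 = n + 2 by ring] at r3
  set b := (if n % 3 = 1 then 2 * (n / 3 + 1) else 1 : ℕ) with hb
  set b' := (if (n + 1) % 3 = 1 then 2 * ((n + 1) / 3 + 1) else 1 : ℕ) with hb'
  have hb'1 : (1 : ℝ) ≤ b' := by
    have : 1 ≤ b' := by rw [hb']; split_ifs <;> omega
    exact_mod_cast this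
  rw [Int.floor_eq_iff, Int.cast_natCast, le_div_iff₀ hp1, div_lt_iff₀ hp1]
  constructor
  · linarith
  · have k1 : u (n + 2) ≤ (b' : ℝ) * u (n + 2) := le_mul_of_one_le_left hp2.le hb'1
    have k2 : (b' : ℝ) * u (n + 2) < u (n + 1) := by linarith
    rw [add_mul, one_mul]
    linarith

/-- … and the next fractional part: `fract (u_n / u_{n+1}) = u_{n+2} / u_{n+1}`. [folklore] -/
theorem fract_eq (n : ℕ) : Int.fract (u n / u (n + 1)) = u (n + 2) / u (n + 1) := by
  rw [← Int.self_sub_floor, floor_eq hu0 hu1 hu2 n, Int.cast_natCast, hu2 n]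
  have hp1 := (seq_pos hu0 hu1 hu2 (n + 1)).ne'
  field_simp

/-- **The complete quotients of `e`.** Mathlib's expansion stream of `e = exp 1` is
`IntFractPair.stream e (n + 1) = ⟨b_n, u_{n+2}/u_{n+1}⟩` (the `(n+1)`-st complete quotient is
`u_n / u_{n+1}`, its integer part is Euler's `a_{n+1} = b_n`). [cite: Angell2021, Thm 4.22] -/
theorem stream_exp_one_succ (n : ℕ) :
    GenContFract.IntFractPair.stream (Real.exp 1) (n + 1) =
      some ⟨((if n % 3 = 1 then 2 * (n / 3 + 1) else 1 : ℕ) : ℤ), u (n + 2) / u (n + 1)⟩ := by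
  have step : ∀ (m : ℕ) (b : ℤ),
      GenContFract.IntFractPair.stream (Real.exp 1) m = some ⟨b, u (m + 1) / u m⟩ →
        GenContFract.IntFractPair.stream (Real.exp 1) (m + 1) =
          some ⟨((if m % 3 = 1 then 2 * (m / 3 + 1) else 1 : ℕ) : ℤ),
            u (m + 2) / u (m + 1)⟩ := by
    intro m b h
    have hne : u (m + 1) / u m ≠ 0 :=
      (div_pos (seq_pos hu0 hu1 hu2 (m + 1)) (seq_pos hu0 hu1 hu2 m)).ne'
    rw [GenContFract.IntFractPair.stream_succ_of_some h hne]
    simp only [GenContFract.IntFractPair.of, inv_div, floor_eq hu0 hu1 hu2 m,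
      fract_eq hu0 hu1 hu2 m]
  induction n with
  | zero =>
    apply step 0 2
    rw [GenContFract.IntFractPair.stream_zero, GenContFract.IntFractPair.of,
      floor_exp_one hu0 hu1 hu2, ← Int.self_sub_floor, floor_exp_one hu0 hu1 hu2, Nat.zero_add,
      hu1, hu0]
    norm_num
  | succ n ih => exact step (n + 1) _ ih

end Recurrence

end EulerContFractExpOne

/-- **Euler's continued fraction of `e`, discharged**: `e = [2; 1, 2, 1, 1, 4, 1, 1, 6, …]` in
Mathlib's `GenContFract.of (Real.exp 1)` (head `2`, `partDens n = 2(⌊n/3⌋ + 1)` if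
`n % 3 = 1`, else `1`). Proof: Hermite's integrals as in [Angell2021, Exercise 4.22 + hint]
(= [Cohn2006, Prop. 1 and Thm 1]), run on the sequence `u_n = |q_{n−1} e − p_{n−1}|` defined by its
recurrence and instantiated here by `Nat.rec`; see the module docstring (`## The argument`).
[cite: Angell2021, Thm 4.22] -/
theorem EulerContFractExpOne_holds : EulerContFractExpOne := by
  obtain ⟨u, hu0, hu1, hu2⟩ : ∃ u : ℕ → ℝ, u 0 = 1 ∧ u 1 = Real.exp 1 - 2 ∧
      ∀ n, u (n + 2) =
        u n - ((if n % 3 = 1 then 2 * (n / 3 + 1) else 1 : ℕ) : ℝ) * u (n + 1) :=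
    ⟨fun n => (Nat.rec (motive := fun _ => ℝ × ℝ) (1, Real.exp 1 - 2)
        (fun m p => (p.2, p.1 - ((if m % 3 = 1 then 2 * (m / 3 + 1) else 1 : ℕ) : ℝ) * p.2))
          n).1,
      rfl, rfl, fun _ => rfl⟩
  refine ⟨?_, fun n => ?_⟩
  · rw [GenContFract.of_h_eq_floor, EulerContFractExpOne.floor_exp_one hu0 hu1 hu2]
    norm_num
  · rw [GenContFract.partDen_eq_s_b
      (GenContFract.get?_of_eq_some_of_succ_get?_intFractPair_stream
        (EulerContFractExpOne.stream_exp_one_succ hu0 hu1 hu2 n))]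
    simp only [Option.some.injEq]
    split_ifs <;> simp only [Int.cast_natCast, Nat.cast_one, Int.cast_one]

end Literature.NumberTheory.DiophantineApproximation
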